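import Mathlib.Data.Nat.Log
import Literature.Computability.AlgebraicComplexity.ValiantClasses
import HarnessLib

/-!
# Crux `PdcQpOfVp` (stmt-ValiantsHypothesis-16003), line `birth` — stub `stub_isQPBounded_mul`:
quasi-polynomially bounded functions are closed under pointwise products

WHAT. In the tree's single-constant form `IsQPBounded t := ∃ c, ∀ n, t n ≤ 2 ^ ((log₂ n + c) ^ c)`
(`Literature/Computability/AlgebraicComplexity/ValiantClasses.lean`), if `a` and `b` are
qp-bounded with constants `c` and `d`, then `n ↦ a n * b n` is qp-bounded with the constant
`c + d + 2`: writing `L := log₂ n` and `e := c + d + 2`,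

  `a n * b n ≤ 2 ^ ((L + c) ^ c) * 2 ^ ((L + d) ^ d) = 2 ^ ((L + c) ^ c + (L + d) ^ d)`,
  `(L + c) ^ c + (L + d) ^ d ≤ 2 · (L + e) ^ (c + d + 1) ≤ (L + e) · (L + e) ^ (c + d + 1) = (L + e) ^ e`

(base and exponent monotonicity of `Nat.pow`, `1 ≤ L + e` and `2 ≤ L + e`).

WHY. The composition `PdcQpOfVp_of` of the line bounds `pdc(per_n) ≤ (n² + 1) · dc(per_n)`;
`dc(per_n)` is qp-bounded (tree) and `n² + 1` is p-bounded hence qp-bounded, so the crux needs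
exactly this closure of qp-bounded functions under pointwise multiplication.

SOURCE. P. Bürgisser, *Completeness and Reduction in Algebraic Complexity Theory* (Springer 2000),
§2.5 (qp-bounded functions, Def. 2.26); P. Bürgisser, M. Clausen, M. A. Shokrollahi, *Algebraic
Complexity Theory* (Springer 1997), §21.5, (21.31): "qp-bounded functions are closed under
products" — folklore arithmetic, proved here from Mathlib only (`Nat.pow_le_pow_left`,
`Nat.pow_le_pow_right`, `pow_add`, `pow_succ'`, `Nat.mul_le_mul`).
-/

-- D-0017 layout: Sub = Summit for this single-conjunct summit, so the namespace repeats a component.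
set_option linter.dupNamespace false

namespace Summit.ValiantsHypothesis.ValiantsHypothesis.Theorems.ProjectionStabilityPdcQpOfVp

open Literature.Computability.AlgebraicComplexity

/-- Exponent bookkeeping for the product of two qp bounds: with `e := c + d + 2`,
`(ℓ + c) ^ c + (ℓ + d) ^ d ≤ (ℓ + e) ^ e`, via `2 · (ℓ + e) ^ (e - 1) ≤ (ℓ + e) ^ e`
(written with the exponents `c + d + 1` and `c + d + 2`, no ℕ-subtraction). [folklore] -/
theorem isQPBounded_mul_exponent_le (ℓ c d : ℕ) :
    (ℓ + c) ^ c + (ℓ + d) ^ d ≤ (ℓ + (c + d + 2)) ^ (c + d + 2) := by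
  have hx1 : (ℓ + c) ^ c ≤ (ℓ + (c + d + 2)) ^ (c + d + 1) :=
    (Nat.pow_le_pow_left (by omega) _).trans (Nat.pow_le_pow_right (by omega) (by omega))
  have hx2 : (ℓ + d) ^ d ≤ (ℓ + (c + d + 2)) ^ (c + d + 1) :=
    (Nat.pow_le_pow_left (by omega) _).trans (Nat.pow_le_pow_right (by omega) (by omega))
  calc (ℓ + c) ^ c + (ℓ + d) ^ d ≤ 2 * (ℓ + (c + d + 2)) ^ (c + d + 1) := by omega
    _ ≤ (ℓ + (c + d + 2)) * (ℓ + (c + d + 2)) ^ (c + d + 1) :=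
        Nat.mul_le_mul_right _ (by omega)
    _ = (ℓ + (c + d + 2)) ^ (c + d + 2) := by rw [← pow_succ']

/-- **STUB 2** of line `birth` of crux `PdcQpOfVp`: quasi-polynomially bounded functions
(`t n ≤ 2 ^ ((log₂ n + c) ^ c)`) are closed under pointwise multiplication — if `a` and `b` are
qp-bounded with constants `c` and `d`, then `n ↦ a n * b n` is qp-bounded with constant `c + d + 2`
(Bürgisser 2000 §2.5; BCS 1997 §21.5). [folklore] -/
theorem stub_isQPBounded_mul :
    ∀ a b : ℕ → ℕ, IsQPBounded a → IsQPBounded b → IsQPBounded (fun n => a n * b n) := by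
  intro a b ha hb
  obtain ⟨c, hc⟩ := ha
  obtain ⟨d, hd⟩ := hb
  refine ⟨c + d + 2, fun n => ?_⟩
  show a n * b n ≤ 2 ^ ((Nat.log 2 n + (c + d + 2)) ^ (c + d + 2))
  calc a n * b n ≤ 2 ^ ((Nat.log 2 n + c) ^ c) * 2 ^ ((Nat.log 2 n + d) ^ d) :=
        Nat.mul_le_mul (hc n) (hd n)
    _ = 2 ^ ((Nat.log 2 n + c) ^ c + (Nat.log 2 n + d) ^ d) := (pow_add 2 _ _).symm
    _ ≤ 2 ^ ((Nat.log 2 n + (c + d + 2)) ^ (c + d + 2)) :=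
        Nat.pow_le_pow_right Nat.two_pos (isQPBounded_mul_exponent_le _ _ _)

end Summit.ValiantsHypothesis.ValiantsHypothesis.Theorems.ProjectionStabilityPdcQpOfVp
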